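import Literature.NumberTheory.LFunctions.SchoenfeldZeroSumsExplicit
import Literature.NumberTheory.LFunctions.ZetaArgBacklundExplicit
import HarnessLib

/-!
# RiemannHypothesis / LiCoefficients — crux `LiFarZeroTail` (RH-FREE zero counting)

Route `RiemannHypothesis/LiCoefficients` (cell `pub/rh-li`, D-0059/D-0061), item `LiFarZeroTail` (L3 of the
theory memo `theory/TARGETS.md` §8.1): for `1000 ≤ T ≤ U`,

  `∑_{T < Im ρ ≤ U} m(ρ)/(Im ρ)⁴ ≤ log T/(6π T³)`,

the sum running over the zeros of `ζ` in the closed critical strip with ordinates in `(T, U]`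
(`SchoenfeldBound.zerosBetween`, multiplicities `riemannZetaZeroOrder`).  RH-FREE: nothing about the
real parts of the zeros is used.

Proof (Rosser–Schoenfeld 1975, Lemma 7 pattern, as in `SchoenfeldZeroSumsExplicit.sum_zerosBetween_le_Gtail`):
partial summation of `f(t) = t⁻⁴` against the zero counting function (`sum_zerosBetween_le_of_count_le`)
with the explicit two–sided count `|N(t) − (t/2π) log(t/2πe)| ≤ 0.3083 log t + 4.128` (`t ≥ 30`,
`abs_zetaZeroCount_sub_main_le_explicit`, Backlund–Trudgian).  With `N⁺(t) = M(t) + 0.3083 log t + 4.128`,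
`N⁻ = M − …`, `M(t) = (t log t − (1 + log 2π) t)/(2π)`, an explicit antiderivative `F` of
`4(N⁺(t) − N⁻(T))/t⁵` gives
`∑ ≤ (N⁺(U) − N⁻(T))/U⁴ + F(U) − F(T) = −R(U) + (log(T/2π) + 1/3)/(6πT³) + (0.6166 log T + 8.33)/T⁴`
with `R(U) = (log(U/2π) + 1/3)/(6πU³) + 0.077/U⁴ ≥ 0`, and the slack `(log 2π − 1/3)/(6πT³)` absorbs the
`T⁻⁴` terms once `T ≥ 1000`.
-/

noncomputable section

-- D-0017: `Summit.<S>.<S>.…` is the designed namespace of a single-problem summit.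
set_option linter.dupNamespace false

open Real Set MeasureTheory intervalIntegral
open scoped Real

namespace Summit.RiemannHypothesis.RiemannHypothesis.Theorems.LiTheory

open Literature.NumberTheory.LFunctions Literature.NumberTheory.LFunctions.SchoenfeldBound

namespace FarZeroTail

/-- The explicit upper count `N⁺(t) = (t log t − (1 + log 2π) t)/(2π) + 0.3083 log t + 4.128`. -/
def nUp4 (t : ℝ) : ℝ :=
  t * Real.log t / (2 * π) - (1 + Real.log (2 * π)) * t / (2 * π) + 0.3083 * Real.log t + 4.128

/-- The explicit lower count `N⁻(t) = (t log t − (1 + log 2π) t)/(2π) − 0.3083 log t − 4.128`. -/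
def nLo4 (t : ℝ) : ℝ :=
  t * Real.log t / (2 * π) - (1 + Real.log (2 * π)) * t / (2 * π) - 0.3083 * Real.log t - 4.128

/-- `(t/2π) log(t/(2πe)) = (t log t − (1 + log 2π) t)/(2π)`. -/
theorem main_eq {t : ℝ} (ht : 0 < t) :
    t / (2 * π) * Real.log (t / (2 * π * Real.exp 1)) =
      t * Real.log t / (2 * π) - (1 + Real.log (2 * π)) * t / (2 * π) := by
  have h2π : (0 : ℝ) < 2 * π := by positivity
  rw [Real.log_div ht.ne' (by positivity), Real.log_mul h2π.ne' (Real.exp_pos 1).ne', Real.log_exp]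
  ring

/-- `N(t) ≤ N⁺(t)` for `t ≥ 30`. -/
theorem count_le_nUp4 {t : ℝ} (ht : 30 ≤ t) : (zetaZeroCount t : ℝ) ≤ nUp4 t := by
  have h := (abs_le.1 (abs_zetaZeroCount_sub_main_le_explicit ht)).2
  rw [main_eq (by linarith)] at h
  unfold nUp4
  linarith

/-- `N⁻(t) ≤ N(t)` for `t ≥ 30`. -/
theorem nLo4_le_count {t : ℝ} (ht : 30 ≤ t) : nLo4 t ≤ (zetaZeroCount t : ℝ) := by
  have h := (abs_le.1 (abs_zetaZeroCount_sub_main_le_explicit ht)).1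
  rw [main_eq (by linarith)] at h
  unfold nLo4
  linarith

/-- `N⁺` is continuous away from `0`. -/
theorem continuousAt_nUp4 {t : ℝ} (ht0 : t ≠ 0) : ContinuousAt nUp4 t := by
  unfold nUp4
  fun_prop (disch := assumption)

/-- `N⁺` is continuous on `[a, b]`, `a > 0`. -/
theorem continuousOn_nUp4 {a b : ℝ} (ha : 0 < a) : ContinuousOn nUp4 (Icc a b) :=
  fun _ ht ↦ (continuousAt_nUp4 (ha.trans_le ht.1).ne').continuousWithinAt

/-- `d/dt (t⁴)⁻¹ = −4/t⁵`. -/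
theorem hasDerivAt_inv_pow4 {t : ℝ} (ht : t ≠ 0) :
    HasDerivAt (fun y : ℝ ↦ (y ^ 4)⁻¹) (-4 / t ^ 5) t := by
  have h := (hasDerivAt_pow 4 t).inv (by positivity)
  refine h.congr_deriv ?_
  field_simp
  ring

/-- The antiderivative `F(c, t)` of `4(N⁺(t) − c)/t⁵`:
`−(2/3π) log t/t³ − (2/9π)/t³ + (2(1 + log 2π)/3π)/t³ − 0.3083 log t/t⁴ − (0.3083/4)/t⁴ − (4.128 − c)/t⁴`. -/
def Fq (c t : ℝ) : ℝ :=
  -(2 / (3 * π)) * Real.log t * (t ^ 3)⁻¹ - 2 / (9 * π) * (t ^ 3)⁻¹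
    + 2 * (1 + Real.log (2 * π)) / (3 * π) * (t ^ 3)⁻¹
    - 0.3083 * Real.log t * (t ^ 4)⁻¹ - 0.3083 / 4 * (t ^ 4)⁻¹ - (4.128 - c) * (t ^ 4)⁻¹

/-- `∂F/∂t = (N⁺(t) − c) · (4/t⁵)` for `t > 0`. -/
theorem hasDerivAt_Fq (c : ℝ) {t : ℝ} (ht : 0 < t) :
    HasDerivAt (Fq c) ((nUp4 t - c) * -(-4 / t ^ 5)) t := by
  have ht0 : t ≠ 0 := ht.ne'
  have hπ : π ≠ 0 := Real.pi_ne_zero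
  have hl : HasDerivAt Real.log t⁻¹ t := Real.hasDerivAt_log ht0
  have h3 := hasDerivAt_inv_cube ht0
  have h4 := hasDerivAt_inv_pow4 ht0
  have h := (((((hl.const_mul (-(2 / (3 * π)))).mul h3).sub (h3.const_mul (2 / (9 * π)))).add
    (h3.const_mul (2 * (1 + Real.log (2 * π)) / (3 * π)))).sub ((hl.const_mul 0.3083).mul h4)).sub
    (h4.const_mul (0.3083 / 4)) |>.sub (h4.const_mul (4.128 - c))
  refine h.congr_deriv ?_
  unfold nUp4
  field_simp
  ring

/-- Boundary term plus the antiderivative at `U`: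
`(N⁺(U) − c)/U⁴ + F(c, U) = −[(log U − log 2π + 1/3)/(6πU³) + (0.3083/4)/U⁴]`. -/
theorem boundary_add_Fq_eq (c : ℝ) {U : ℝ} (hU : 0 < U) :
    (nUp4 U - c) * (U ^ 4)⁻¹ + Fq c U =
      -((Real.log U - Real.log (2 * π) + 1 / 3) / (6 * π) * (U ^ 3)⁻¹ + 0.3083 / 4 * (U ^ 4)⁻¹) := by
  have hπ := Real.pi_pos
  unfold nUp4 Fq
  field_simp
  ring

/-- `−F(N⁻(T), T) = (log T − log 2π + 1/3)/(6πT³) + (0.6166 log T + 0.3083/4 + 8.256)/T⁴`. -/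
theorem neg_Fq_nLo4_eq {T : ℝ} (hT : 0 < T) :
    -Fq (nLo4 T) T = (Real.log T - Real.log (2 * π) + 1 / 3) / (6 * π) * (T ^ 3)⁻¹
      + (2 * 0.3083 * Real.log T + 0.3083 / 4 + 2 * 4.128) * (T ^ 4)⁻¹ := by
  have hπ := Real.pi_pos
  unfold Fq nLo4
  field_simp
  ring

/-- `log(2π) ≥ 1.8` (`e^{1.8} · e^{0.2} = e² < 7.39`, `e^{0.2} ≥ 1.2`, `2π > 6.28`). -/
theorem log_two_pi_ge : (1.8 : ℝ) ≤ Real.log (2 * π) := by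
  have hπ := Real.pi_gt_d2
  have he := Real.exp_one_lt_d9
  rw [Real.le_log_iff_exp_le (by positivity)]
  have h02 : (1.2 : ℝ) ≤ Real.exp 0.2 := by
    have := Real.add_one_le_exp (0.2 : ℝ); linarith
  have h18 : Real.exp 1.8 * Real.exp 0.2 = Real.exp 1 * Real.exp 1 := by
    rw [← Real.exp_add, ← Real.exp_add]; norm_num
  have hpos := Real.exp_pos (1.8 : ℝ)
  have he0 := Real.exp_pos (1 : ℝ)
  nlinarith [mul_le_mul_of_nonneg_left h02 hpos.le]

end FarZeroTail

open FarZeroTail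

/-- **Crux `LiFarZeroTail` (RH-FREE zero counting).**  For `1000 ≤ T ≤ U`,
`∑_{T < Im ρ ≤ U} m(ρ)/(Im ρ)⁴ ≤ log T/(6π T³)` — partial summation of `t⁻⁴` against the explicit
two-sided zero count `|N(t) − (t/2π)log(t/2πe)| ≤ 0.3083 log t + 4.128` (Backlund–Trudgian); main term
`(log(T/2π) + 1/3)/(6πT³)`, the slack `(log 2π − 1/3)/(6πT³)` absorbing the `S(t)`-terms
`(0.6166 log T + 8.34)/T⁴`. -/
theorem liFarZeroTail_bound :
    ∀ (T U : ℝ), 1000 ≤ T → T ≤ U →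
      ∑ ρ ∈ Literature.NumberTheory.LFunctions.SchoenfeldBound.zerosBetween T U,
          (Literature.NumberTheory.LFunctions.riemannZetaZeroOrder ρ : ℝ) / ρ.im ^ 4 ≤
        Real.log T / (6 * Real.pi * T ^ 3) := by
  intro T U hT hU
  have hT0 : 0 < T := by linarith
  have hU0 : 0 < U := by linarith
  have hπ := Real.pi_pos
  -- partial summation with `f = t⁻⁴`, `N ≤ N⁺` on `[T, U]`
  have h := sum_zerosBetween_le_of_count_le (T₁ := T) (T₂ := U) hT0.le hU
    (f := fun t ↦ (t ^ 4)⁻¹) (f' := fun t ↦ -4 / t ^ 5) (Nup := nUp4)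
    (fun t ht ↦ hasDerivAt_inv_pow4 (by linarith [ht.1] : t ≠ 0))
    (continuousOn_of_forall_continuousAt fun t ht ↦ by
      have h0 : t ≠ 0 := by linarith [ht.1]
      have h5 : t ^ 5 ≠ 0 := pow_ne_zero 5 h0
      fun_prop (disch := assumption))
    (fun t ht ↦ by
      have : 0 < t := by linarith [ht.1]
      exact div_nonpos_of_nonpos_of_nonneg (by norm_num) (by positivity))
    (by positivity) (fun t ht ↦ count_le_nUp4 (by linarith [ht.1])) (continuousOn_nUp4 hT0)
  -- replace `N(T)` by `N⁻(T)`
  have hN := nLo4_le_count (t := T) (by linarith)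
  have hbd : (nUp4 U - zetaZeroCount T) * (U ^ 4)⁻¹ ≤ (nUp4 U - nLo4 T) * (U ^ 4)⁻¹ :=
    mul_le_mul_of_nonneg_right (by linarith) (by positivity)
  have hcont : ∀ c : ℝ, ContinuousOn (fun t ↦ (nUp4 t - c) * -(-4 / t ^ 5)) (Icc T U) := fun c ↦
    continuousOn_of_forall_continuousAt fun t ht ↦ by
      have h0 : t ≠ 0 := by linarith [ht.1]
      have h5 : t ^ 5 ≠ 0 := pow_ne_zero 5 h0
      refine ((continuousAt_nUp4 h0).sub continuousAt_const).mul ?_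
      fun_prop (disch := assumption)
  have hint_le : ∫ t in T..U, (nUp4 t - zetaZeroCount T) * -(-4 / t ^ 5) ≤
      ∫ t in T..U, (nUp4 t - nLo4 T) * -(-4 / t ^ 5) := by
    refine integral_mono_on hU ((hcont _).intervalIntegrable_of_Icc hU)
      ((hcont _).intervalIntegrable_of_Icc hU) fun t ht ↦ ?_
    have : 0 < t := by linarith [ht.1]
    have : 0 ≤ -(-4 / t ^ 5) := by rw [neg_div, neg_neg]; positivity
    nlinarith
  -- evaluate the integral by the antiderivative
  have hFTC : ∫ t in T..U, (nUp4 t - nLo4 T) * -(-4 / t ^ 5) = Fq (nLo4 T) U - Fq (nLo4 T) T := by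
    refine integral_eq_sub_of_hasDerivAt (fun t ht ↦ ?_) ((hcont _).intervalIntegrable_of_Icc hU)
    rw [uIcc_of_le hU] at ht
    exact hasDerivAt_Fq _ (by linarith [ht.1])
  -- the sum rewritten with `/`
  have hsum : ∑ ρ ∈ zerosBetween T U, (riemannZetaZeroOrder ρ : ℝ) / ρ.im ^ 4 =
      ∑ ρ ∈ zerosBetween T U, (riemannZetaZeroOrder ρ : ℝ) * (ρ.im ^ 4)⁻¹ :=
    Finset.sum_congr rfl fun ρ _ ↦ div_eq_mul_inv _ _
  rw [hsum]
  -- the `U`-remainder is non-positive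
  have hrem : (nUp4 U - nLo4 T) * (U ^ 4)⁻¹ + Fq (nLo4 T) U ≤ 0 := by
    rw [boundary_add_Fq_eq]
    · have hlogU : 2 ≤ Real.log U := by
        rw [Real.le_log_iff_exp_le (by linarith)]
        have he := Real.exp_one_lt_d9
        have h2 : Real.exp 2 = Real.exp 1 * Real.exp 1 := by rw [← Real.exp_add]; norm_num
        rw [h2]
        nlinarith [Real.exp_pos (1 : ℝ)]
      have h2π : Real.log (2 * π) ≤ 2 := by
        have hπ' := Real.pi_lt_d2
        have he := Real.exp_one_gt_d9
        rw [Real.log_le_iff_le_exp (by positivity)]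
        have h2 : Real.exp 2 = Real.exp 1 * Real.exp 1 := by rw [← Real.exp_add]; norm_num
        rw [h2]
        nlinarith
      have : 0 ≤ (Real.log U - Real.log (2 * π) + 1 / 3) / (6 * π) * (U ^ 3)⁻¹ := by
        have : 0 ≤ Real.log U - Real.log (2 * π) + 1 / 3 := by linarith
        positivity
      have : (0 : ℝ) ≤ 0.3083 / 4 * (U ^ 4)⁻¹ := by positivity
      linarith
    · exact hU0
  -- the value at `T`
  have hmain : -Fq (nLo4 T) T ≤ Real.log T / (6 * π * T ^ 3) := by
    rw [neg_Fq_nLo4_eq hT0]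
    have h2π := log_two_pi_ge
    have hlogT : Real.log T ≤ 6 + T / 1000 := by
      -- `log T ≤ log 1000 + (T − 1000)/1000 ≤ 6 + T/1000`
      have h1 : Real.log T ≤ Real.log 1000 + (T / 1000 - 1) := by
        have := Real.log_le_sub_one_of_pos (show 0 < T / 1000 by positivity)
        have hdiv : Real.log (T / 1000) = Real.log T - Real.log 1000 :=
          Real.log_div hT0.ne' (by norm_num)
        linarith
      have h7 : Real.log 1000 ≤ 7 := by
        rw [Real.log_le_iff_le_exp (by norm_num)]
        have he := Real.exp_one_gt_d9
        have h7 : Real.exp 7 = Real.exp 1 ^ 7 := by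
          rw [← Real.exp_nat_mul]; norm_num
        rw [h7]
        exact le_trans (by norm_num) (pow_le_pow_left₀ (by norm_num) he.le 7)
      linarith
    -- it remains: (−log 2π + 1/3)/(6π T³) + (0.6166 log T + 8.333)/T⁴ ≤ 0
    have hT3 : 0 < T ^ 3 := by positivity
    have hT4 : 0 < T ^ 4 := by positivity
    have key : (2 * 0.3083 * Real.log T + 0.3083 / 4 + 2 * 4.128) * (T ^ 4)⁻¹ ≤
        (Real.log (2 * π) - 1 / 3) / (6 * π) * (T ^ 3)⁻¹ := by
      rw [show (T ^ 4)⁻¹ = T⁻¹ * (T ^ 3)⁻¹ by rw [← mul_inv, ← pow_succ'], ← mul_assoc]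
      refine mul_le_mul_of_nonneg_right ?_ (by positivity)
      rw [← div_eq_mul_inv, div_le_div_iff₀ hT0 (by positivity)]
      have hA : 2 * 0.3083 * Real.log T + 0.3083 / 4 + 2 * 4.128 ≤ 12.04 + 0.00062 * T := by
        linarith [hlogT]
      have hA0 : 0 ≤ 2 * 0.3083 * Real.log T + 0.3083 / 4 + 2 * 4.128 := by
        have : 0 ≤ Real.log T := Real.log_nonneg (by linarith)
        positivity
      have hB : 6 * π ≤ 18.9 := by linarith [Real.pi_lt_d2]
      calc (2 * 0.3083 * Real.log T + 0.3083 / 4 + 2 * 4.128) * (6 * π)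
          ≤ (12.04 + 0.00062 * T) * 18.9 := mul_le_mul hA hB (by positivity) (by positivity)
        _ ≤ (1.8 - 1 / 3) * T := by linarith
        _ ≤ (Real.log (2 * π) - 1 / 3) * T := mul_le_mul_of_nonneg_right (by linarith) hT0.le
    have e : Real.log T / (6 * π * T ^ 3) =
        (Real.log T - Real.log (2 * π) + 1 / 3) / (6 * π) * (T ^ 3)⁻¹ +
          (Real.log (2 * π) - 1 / 3) / (6 * π) * (T ^ 3)⁻¹ := by
      field_simp
      ring
    rw [e]
    linarith
  linarith [h, hbd, hint_le, hFTC, hrem, hmain]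

end Summit.RiemannHypothesis.RiemannHypothesis.Theorems.LiTheory

end
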